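import Summits.CriticalPhenomena.PercolationContinuityZ3.Theorems.PercNearOneGluingNoHeavyLowerTailSahiHittingSlot

/-!
# `NoHeavyLowerTail` (crux stmt-CriticalPhenomena-4575), Sahi / Kahn positivity: COVERAGE FUNCTIONS in the first slot

Support file (cell `prim-l12`, seat P3, gen 3; `--supports stmt-CriticalPhenomena-4575`).  No `sorry`, no definitions, no named facts, standard axioms.

`E₃(f, g, h)` is linear in each slot, so the cone of first slots `f` with `E₃(f, 1_U, 1_V) ≥ 0` for ALL increasing `U, V` is convex.  By
`…SahiHittingSlot` it contains every hitting indicator `1_{H_A}`; hence (`sahiE_three_coverage_nonneg`) it contains every WEIGHTED COVERAGE FUNCTION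
`f(ω) = Σ_j c_j · 1[ω ∩ A_j ≠ ∅]`, `c_j ≥ 0` (e.g. the number of groups `A_j` met by `ω`): `E₃(f, 1_U, 1_V) ≥ 0` for all increasing `U, V`, every finite
cube, every product weight.  The bookkeeping lemma `sahiE_three_sum_smul_nonneg` (nonnegative combinations in the first slot preserve `E₃(·,u,v) ≥ 0`) is
stated for arbitrary weights and functions. [this work]
-/

noncomputable section

open scoped Classical

namespace Summit.CriticalPhenomena.PercolationContinuityZ3.Theorems

namespace SahiHittingSlot

open Finset
open Literature.Combinatorics.Sahi2008
open Literature.Probability.Percolation.DecisionTree (ind)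

variable {α : Type} [Fintype α]

/-- `E₃` is linear in its first slot (from the closed form `sahiE_three` and linearity of `ex`). [folklore] -/
theorem sahiE_three_lin_first (μ : α → ℝ) (a b : ℝ) (g₁ g₂ u v : α → ℝ) :
    sahiE μ 3 ![a • g₁ + b • g₂, u, v] = a * sahiE μ 3 ![g₁, u, v] + b * sahiE μ 3 ![g₂, u, v] := by
  have h1 : (a • g₁ + b • g₂) * u * v = a • (g₁ * u * v) + b • (g₂ * u * v) := by
    funext x; simp only [Pi.mul_apply, Pi.add_apply, Pi.smul_apply, smul_eq_mul]; ring
  have h2 : (a • g₁ + b • g₂) * v = a • (g₁ * v) + b • (g₂ * v) := by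
    funext x; simp only [Pi.mul_apply, Pi.add_apply, Pi.smul_apply, smul_eq_mul]; ring
  have h3 : (a • g₁ + b • g₂) * u = a • (g₁ * u) + b • (g₂ * u) := by
    funext x; simp only [Pi.mul_apply, Pi.add_apply, Pi.smul_apply, smul_eq_mul]; ring
  rw [sahiE_three, sahiE_three, sahiE_three, h1, h2, h3]
  simp only [ex_add, ex_smul]
  ring

/-- **Nonnegative combinations in the first slot preserve `E₃(·, u, v) ≥ 0`.** [folklore] -/
theorem sahiE_three_sum_smul_nonneg (μ : α → ℝ) {J : Type} (s : Finset J) (c : J → ℝ) (g : J → α → ℝ) (u v : α → ℝ)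
    (hc : ∀ j ∈ s, 0 ≤ c j) (hg : ∀ j ∈ s, 0 ≤ sahiE μ 3 ![g j, u, v]) :
    0 ≤ sahiE μ 3 ![fun x => ∑ j ∈ s, c j * g j x, u, v] := by
  induction s using Finset.induction_on with
  | empty =>
    have h0 : (fun x : α => ∑ j ∈ (∅ : Finset J), c j * g j x) = (0 : ℝ) • u + (0 : ℝ) • u := by
      funext x; simp
    rw [h0, sahiE_three_lin_first]; simp
  | insert j s hj ih =>
    have h1 : (fun x : α => ∑ k ∈ insert j s, c k * g k x) = c j • g j + (1 : ℝ) • (fun x => ∑ k ∈ s, c k * g k x) := by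
      funext x; simp [sum_insert hj]
    rw [h1, sahiE_three_lin_first, one_mul]
    exact add_nonneg (mul_nonneg (hc j (mem_insert_self j s)) (hg j (mem_insert_self j s)))
      (ih (fun k hk => hc k (mem_insert_of_mem hk)) (fun k hk => hg k (mem_insert_of_mem hk)))

/-- **Kahn / Sahi positivity with a WEIGHTED COVERAGE FUNCTION in the first slot.**  For every finite cube, every product weight, every finite family of
coordinate sets `A_j` with weights `c_j ≥ 0`, and ALL increasing events `U, V`:
`E₃(Σ_j c_j·1_{H_{A_j}}, 1_U, 1_V) ≥ 0`, `H_{A_j} = {ω | ∃ a ∈ A_j, a ∈ ω}`. [this work] -/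
theorem sahiE_three_coverage_nonneg {ι : Type} [Fintype ι] (p : ι → unitInterval) {J : Type} (s : Finset J) (c : J → ℝ)
    (A : J → Finset ι) (hc : ∀ j ∈ s, 0 ≤ c j) {U V : Set (Set ι)} (hU : IsUpperSet U) (hV : IsUpperSet V) :
    0 ≤ sahiE (bernoulliWeight p) 3 ![fun ω => ∑ j ∈ s, c j * ind {ω : Set ι | ∃ a ∈ A j, a ∈ ω} ω, ind U, ind V] :=
  sahiE_three_sum_smul_nonneg _ s c (fun j => ind {ω : Set ι | ∃ a ∈ A j, a ∈ ω}) (ind U) (ind V) hc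
    fun j _ => sahiE_three_hit_nonneg p (A j) hU hV

end SahiHittingSlot

end Summit.CriticalPhenomena.PercolationContinuityZ3.Theorems
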